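import Mathlib
import Summits.FinalStateConjecture.FinalStateConjecture.Theorems.EternalPapapetrouSchwarzschildExteriorModeRigiditySmoothing
import HarnessLib

/-!
# Route EternalPapapetrou · SchwarzschildExteriorModeRigidity — bounds for the mollified jet

Helper file for item stmt-FinalStateConjecture-10039 (`SchwarzschildExteriorModeRigidity`).

If the raw jet `J` has `V, Vt, Vr` bounded on the strip and the kernel `k` is `C¹` with compact
support, then the mollified jet `J.smoothJet` has uniform-in-`t` bounds of all six components on
every compact `r`-range: `Vtt₁ = (k' ⋆ Vt)`, `Vtr₁ = (k' ⋆ Vr)` (the time derivative falls on the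
kernel), and `Vrr₁` is solved for from the reduced equation (ellipticity `1 − 2M/r > 0` on
`r > 2M`). [folklore]
-/

set_option linter.dupNamespace false

noncomputable section

namespace Summit.FinalStateConjecture.FinalStateConjecture.Theorems

open MeasureTheory Set Filter Topology Metric
open scoped Convolution

namespace EternalPapapetrou.ModeRigidity

variable {E : Type*} [NormedAddCommGroup E] [NormedSpace ℝ E] [CompleteSpace E]

namespace RWJet

variable {M : ℝ} {Λ : E →L[ℝ] E}

omit [CompleteSpace E] in
/-- The time derivative of `V` along the strip is `Vt`. [folklore] -/
theorem hasDerivAt_V (J : RWJet M Λ) {p : ℝ × ℝ} (hp : p ∈ strip M) :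
    HasDerivAt (fun t ↦ J.V (t, p.2)) (J.Vt p) p.1 := by
  have hc : HasDerivAt (fun t : ℝ ↦ ((t, p.2) : ℝ × ℝ)) e₁ p.1 :=
    (hasDerivAt_id p.1).prodMk (hasDerivAt_const p.1 p.2) |>.congr_deriv (by simp)
  have := (J.hasFDerivAt p hp).comp_hasDerivAt p.1 hc
  simpa [Function.comp_def, L₁_apply] using this

omit [CompleteSpace E] in
/-- The time derivative of `Vt` along the strip is `Vtt`. [folklore] -/
theorem hasDerivAt_Vt (J : RWJet M Λ) {p : ℝ × ℝ} (hp : p ∈ strip M) :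
    HasDerivAt (fun t ↦ J.Vt (t, p.2)) (J.Vtt p) p.1 := by
  have hc : HasDerivAt (fun t : ℝ ↦ ((t, p.2) : ℝ × ℝ)) e₁ p.1 :=
    (hasDerivAt_id p.1).prodMk (hasDerivAt_const p.1 p.2) |>.congr_deriv (by simp)
  have := (J.hasFDerivAt_t p hp).comp_hasDerivAt p.1 hc
  simpa [Function.comp_def, L₁_apply] using this

omit [CompleteSpace E] in
/-- The time derivative of `Vr` along the strip is `Vtr`. [folklore] -/
theorem hasDerivAt_Vr (J : RWJet M Λ) {p : ℝ × ℝ} (hp : p ∈ strip M) :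
    HasDerivAt (fun t ↦ J.Vr (t, p.2)) (J.Vtr p) p.1 := by
  have hc : HasDerivAt (fun t : ℝ ↦ ((t, p.2) : ℝ × ℝ)) e₁ p.1 :=
    (hasDerivAt_id p.1).prodMk (hasDerivAt_const p.1 p.2) |>.congr_deriv (by simp)
  have := (J.hasFDerivAt_r p hp).comp_hasDerivAt p.1 hc
  simpa [Function.comp_def, L₁_apply] using this

omit [NormedSpace ℝ E] [CompleteSpace E] in
/-- A slice `τ ↦ U (τ, r)` of a function continuous on the strip is continuous (`r > 2M`).
[folklore] -/
theorem continuous_fixed_r {U : ℝ × ℝ → E} (hU : ContinuousOn U (strip M)) {r : ℝ}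
    (hr : r ∈ Ioi (2 * M)) : Continuous fun τ : ℝ ↦ U (τ, r) :=
  hU.comp_continuous (by fun_prop) fun τ ↦ ⟨mem_univ _, hr⟩

/-- **The time derivative falls on the kernel**: for `k ∈ C¹` with compact support,
`Vtt` of the mollified jet is `timeConv k' Vt`. [folklore] -/
theorem smoothJet_Vtt_eq (J : RWJet M Λ) {k : ℝ → ℝ} (hk1 : ContDiff ℝ 1 k)
    (hks : HasCompactSupport k) {p : ℝ × ℝ} (hp : p ∈ strip M) :
    (J.smoothJet hk1.continuous hks).Vtt p = timeConv (deriv k) J.Vt p := by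
  have h1 : HasDerivAt (fun t ↦ timeConv k J.Vt (t, p.2)) ((J.smoothJet hk1.continuous hks).Vtt p)
      p.1 := (J.smoothJet hk1.continuous hks).hasDerivAt_Vt hp
  have h2 : HasDerivAt (fun t ↦ timeConv k J.Vt (t, p.2)) (timeConv (deriv k) J.Vt p) p.1 :=
    hks.hasDerivAt_convolution_left (ContinuousLinearMap.lsmul ℝ ℝ) hk1
      (continuous_fixed_r J.continuousOn_t hp.2).locallyIntegrable p.1
  exact h1.unique h2

/-- Likewise `Vtr` of the mollified jet is `timeConv k' Vr`. [folklore] -/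
theorem smoothJet_Vtr_eq (J : RWJet M Λ) {k : ℝ → ℝ} (hk1 : ContDiff ℝ 1 k)
    (hks : HasCompactSupport k) {p : ℝ × ℝ} (hp : p ∈ strip M) :
    (J.smoothJet hk1.continuous hks).Vtr p = timeConv (deriv k) J.Vr p := by
  have h1 : HasDerivAt (fun t ↦ timeConv k J.Vr (t, p.2)) ((J.smoothJet hk1.continuous hks).Vtr p)
      p.1 := (J.smoothJet hk1.continuous hks).hasDerivAt_Vr hp
  have h2 : HasDerivAt (fun t ↦ timeConv k J.Vr (t, p.2)) (timeConv (deriv k) J.Vr p) p.1 :=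
    hks.hasDerivAt_convolution_left (ContinuousLinearMap.lsmul ℝ ℝ) hk1
      (continuous_fixed_r J.continuousOn_r hp.2).locallyIntegrable p.1
  exact h1.unique h2

omit [CompleteSpace E] in
/-- **Ellipticity in `r`**: the reduced equation solved for `Vrr`, as a norm bound, for
`0 < M`, `2M < a ≤ r`. [folklore] -/
theorem norm_Vrr_le (J : RWJet M Λ) (hM : 0 < M) {a : ℝ} (ha : 2 * M < a) {p : ℝ × ℝ}
    (hp : p ∈ strip M) (har : a ≤ p.2) :
    ‖J.Vrr p‖ ≤ (1 - 2 * M / a)⁻¹ *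
      ((1 + 2 * M / a + 4 * M / a + 2 * M / a ^ 2 + 2 / a * (1 + M / a) + (a ^ 2)⁻¹) *
        (‖J.Vtt p‖ + ‖J.Vtr p‖ + ‖J.Vt p‖ + ‖J.Vr p‖ + ‖Λ‖ * ‖J.V p‖)) := by
  set r := p.2 with hr
  have ha0 : 0 < a := by linarith
  have hr0 : 0 < r := by linarith
  have hDa : 0 < 1 - 2 * M / a := by
    rw [sub_pos, div_lt_one ha0]; linarith
  have hD : 1 - 2 * M / a ≤ 1 - 2 * M / r := by
    have : 2 * M / r ≤ 2 * M / a := div_le_div_of_nonneg_left (by linarith) ha0 har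
    linarith
  have hDr : 0 < 1 - 2 * M / r := lt_of_lt_of_le hDa hD
  set Q := 1 + 2 * M / a + 4 * M / a + 2 * M / a ^ 2 + 2 / a * (1 + M / a) + (a ^ 2)⁻¹ with hQ
  -- bounds for the coefficients
  have hMr : M / r ≤ M / a := div_le_div_of_nonneg_left hM.le ha0 har
  have h2Mr : 2 * M / r ≤ 2 * M / a := div_le_div_of_nonneg_left (by linarith) ha0 har
  have h4Mr : 4 * M / r ≤ 4 * M / a := div_le_div_of_nonneg_left (by linarith) ha0 har
  have hr2 : (r ^ 2)⁻¹ ≤ (a ^ 2)⁻¹ := by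
    rw [inv_le_inv₀ (by positivity) (by positivity)]; exact pow_le_pow_left₀ ha0.le har 2
  have h2Mr2 : 2 * M / r ^ 2 ≤ 2 * M / a ^ 2 := by
    rw [div_eq_mul_inv, div_eq_mul_inv]; exact mul_le_mul_of_nonneg_left hr2 (by linarith)
  have h2r : 2 / r ≤ 2 / a := div_le_div_of_nonneg_left (by norm_num) ha0 har
  have hnn : 0 ≤ 2 * M / a ∧ 0 ≤ 4 * M / a ∧ 0 ≤ 2 * M / a ^ 2 ∧ 0 ≤ 2 / a * (1 + M / a) ∧
      0 ≤ (a ^ 2)⁻¹ := ⟨by positivity, by positivity, by positivity, by positivity, by positivity⟩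
  have c1 : |(-(1 + 2 * M / r))| ≤ Q := by
    rw [abs_neg, abs_of_nonneg (by positivity)]; rw [hQ]; linarith [hnn.1, hnn.2.1]
  have c2 : |4 * M / r| ≤ Q := by
    rw [abs_of_nonneg (by positivity)]; rw [hQ]; linarith [hnn.1, hnn.2.1]
  have c3 : |2 * M / r ^ 2| ≤ Q := by
    rw [abs_of_nonneg (by positivity)]; rw [hQ]; linarith [hnn.1, hnn.2.1]
  have c5 : |2 / r * (1 - M / r)| ≤ Q := by
    have : |2 / r * (1 - M / r)| ≤ 2 / a * (1 + M / a) := by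
      rw [abs_mul, abs_of_nonneg (by positivity : (0 : ℝ) ≤ 2 / r)]
      refine mul_le_mul h2r ((abs_sub _ _).trans ?_) (abs_nonneg _) (by positivity)
      rw [abs_one, abs_of_nonneg (by positivity)]; linarith
    rw [hQ]; linarith [hnn.1, hnn.2.1]
  have c6 : |(r ^ 2)⁻¹| ≤ Q := by
    rw [abs_of_nonneg (by positivity)]; rw [hQ]; linarith [hnn.1, hnn.2.1]
  have hQ0 : 0 ≤ Q := (abs_nonneg _).trans c2
  -- solve the equation for `Vrr`
  have hpde := J.pde p hp
  simp only [rwOp, ← hr] at hpde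
  have hsol : (1 - 2 * M / r) • J.Vrr p = -((-(1 + 2 * M / r)) • J.Vtt p + (4 * M / r) • J.Vtr p +
      (2 * M / r ^ 2) • J.Vt p + (2 / r * (1 - M / r)) • J.Vr p + (r ^ 2)⁻¹ • Λ (J.V p)) := by
    rw [eq_neg_iff_add_eq_zero, ← hpde]; abel
  have hnorm : (1 - 2 * M / r) * ‖J.Vrr p‖ ≤ Q * (‖J.Vtt p‖ + ‖J.Vtr p‖ + ‖J.Vt p‖ + ‖J.Vr p‖ +
      ‖Λ‖ * ‖J.V p‖) := by
    have := congrArg norm hsol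
    rw [norm_smul, Real.norm_eq_abs, abs_of_pos hDr, norm_neg] at this
    rw [this]
    have hΛ : ‖Λ (J.V p)‖ ≤ ‖Λ‖ * ‖J.V p‖ := Λ.le_opNorm _
    have t1 : ‖(-(1 + 2 * M / r)) • J.Vtt p‖ ≤ Q * ‖J.Vtt p‖ := by
      rw [norm_smul, Real.norm_eq_abs]; exact mul_le_mul_of_nonneg_right c1 (norm_nonneg _)
    have t2 : ‖(4 * M / r) • J.Vtr p‖ ≤ Q * ‖J.Vtr p‖ := by
      rw [norm_smul, Real.norm_eq_abs]; exact mul_le_mul_of_nonneg_right c2 (norm_nonneg _)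
    have t3 : ‖(2 * M / r ^ 2) • J.Vt p‖ ≤ Q * ‖J.Vt p‖ := by
      rw [norm_smul, Real.norm_eq_abs]; exact mul_le_mul_of_nonneg_right c3 (norm_nonneg _)
    have t5 : ‖(2 / r * (1 - M / r)) • J.Vr p‖ ≤ Q * ‖J.Vr p‖ := by
      rw [norm_smul, Real.norm_eq_abs]; exact mul_le_mul_of_nonneg_right c5 (norm_nonneg _)
    have t6 : ‖(r ^ 2)⁻¹ • Λ (J.V p)‖ ≤ Q * (‖Λ‖ * ‖J.V p‖) := by
      rw [norm_smul, Real.norm_eq_abs]; exact mul_le_mul c6 hΛ (norm_nonneg _) hQ0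
    have tri : ‖(-(1 + 2 * M / r)) • J.Vtt p + (4 * M / r) • J.Vtr p + (2 * M / r ^ 2) • J.Vt p +
        (2 / r * (1 - M / r)) • J.Vr p + (r ^ 2)⁻¹ • Λ (J.V p)‖ ≤
        ‖(-(1 + 2 * M / r)) • J.Vtt p‖ + ‖(4 * M / r) • J.Vtr p‖ + ‖(2 * M / r ^ 2) • J.Vt p‖ +
        ‖(2 / r * (1 - M / r)) • J.Vr p‖ + ‖(r ^ 2)⁻¹ • Λ (J.V p)‖ := by
      refine (norm_add_le _ _).trans (add_le_add ?_ le_rfl)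
      refine (norm_add_le _ _).trans (add_le_add ?_ le_rfl)
      refine (norm_add_le _ _).trans (add_le_add ?_ le_rfl)
      exact norm_add_le _ _
    linarith
  calc ‖J.Vrr p‖ = (1 - 2 * M / r)⁻¹ * ((1 - 2 * M / r) * ‖J.Vrr p‖) :=
        (inv_mul_cancel_left₀ hDr.ne' _).symm
    _ ≤ (1 - 2 * M / a)⁻¹ * ((1 - 2 * M / r) * ‖J.Vrr p‖) := by
        apply mul_le_mul_of_nonneg_right _ (by positivity)
        exact (inv_le_inv₀ hDr hDa).2 hD
    _ ≤ _ := mul_le_mul_of_nonneg_left hnorm (by positivity)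

/-- **Bounds of the mollified jet.** If `V, Vt, Vr` of `J` are bounded by `C₁` on the strip,
`0 < M`, and `k ∈ C¹` has compact support, the mollified jet has uniform-in-`t` bounds on every
compact `r`-range. [folklore] -/
def smoothJetBounds (J : RWJet M Λ) (hM : 0 < M) {C₁ : ℝ}
    (hb : ∀ p ∈ strip M, ‖J.V p‖ ≤ C₁ ∧ ‖J.Vt p‖ ≤ C₁ ∧ ‖J.Vr p‖ ≤ C₁)
    {k : ℝ → ℝ} (hk1 : ContDiff ℝ 1 k) (hks : HasCompactSupport k) :
    (J.smoothJet hk1.continuous hks).Bounds :=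
  let B : ℝ := max ((∫ s, ‖k s‖) * C₁) ((∫ s, ‖deriv k s‖) * C₁)
  { C := fun a _ ↦ max B ((1 - 2 * M / a)⁻¹ *
      ((1 + 2 * M / a + 4 * M / a + 2 * M / a ^ 2 + 2 / a * (1 + M / a) + (a ^ 2)⁻¹) *
        ((4 + ‖Λ‖) * B)))
    le := by
      intro a b ha hab p hp
      have hk : Integrable k := hk1.continuous.integrable_of_hasCompactSupport hks
      have hk' : Integrable (deriv k) :=
        (hk1.continuous_deriv le_rfl).integrable_of_hasCompactSupport hks.deriv
      have hps : p ∈ strip M := ⟨mem_univ _, lt_of_lt_of_le ha hp.1⟩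
      set J₁ := J.smoothJet hk1.continuous hks with hJ₁
      have hV : ‖J₁.V p‖ ≤ B := (norm_timeConv_le hk fun τ ↦ (hb (τ, p.2) ⟨mem_univ _, hps.2⟩).1).trans
        (le_max_left _ _)
      have hVt : ‖J₁.Vt p‖ ≤ B :=
        (norm_timeConv_le hk fun τ ↦ (hb (τ, p.2) ⟨mem_univ _, hps.2⟩).2.1).trans (le_max_left _ _)
      have hVr : ‖J₁.Vr p‖ ≤ B :=
        (norm_timeConv_le hk fun τ ↦ (hb (τ, p.2) ⟨mem_univ _, hps.2⟩).2.2).trans (le_max_left _ _)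
      have hVtt : ‖J₁.Vtt p‖ ≤ B := by
        rw [hJ₁, J.smoothJet_Vtt_eq hk1 hks hps]
        exact (norm_timeConv_le hk' fun τ ↦ (hb (τ, p.2) ⟨mem_univ _, hps.2⟩).2.1).trans
          (le_max_right _ _)
      have hVtr : ‖J₁.Vtr p‖ ≤ B := by
        rw [hJ₁, J.smoothJet_Vtr_eq hk1 hks hps]
        exact (norm_timeConv_le hk' fun τ ↦ (hb (τ, p.2) ⟨mem_univ _, hps.2⟩).2.2).trans
          (le_max_right _ _)
      have hB0 : 0 ≤ B := (norm_nonneg _).trans hV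
      have hVrr := J₁.norm_Vrr_le hM ha hps hp.1
      have hsum : ‖J₁.Vtt p‖ + ‖J₁.Vtr p‖ + ‖J₁.Vt p‖ + ‖J₁.Vr p‖ + ‖Λ‖ * ‖J₁.V p‖ ≤ (4 + ‖Λ‖) * B := by
        have := mul_le_mul_of_nonneg_left hV (norm_nonneg Λ)
        linarith
      have ha0 : 0 < a := by linarith
      have hDa : 0 < 1 - 2 * M / a := by rw [sub_pos, div_lt_one ha0]; linarith
      have hVrr' : ‖J₁.Vrr p‖ ≤ (1 - 2 * M / a)⁻¹ *
          ((1 + 2 * M / a + 4 * M / a + 2 * M / a ^ 2 + 2 / a * (1 + M / a) + (a ^ 2)⁻¹) *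
            ((4 + ‖Λ‖) * B)) :=
        hVrr.trans (mul_le_mul_of_nonneg_left (mul_le_mul_of_nonneg_left hsum (by positivity))
          (by positivity))
      exact ⟨hV.trans (le_max_left _ _), hVt.trans (le_max_left _ _), hVr.trans (le_max_left _ _),
        hVtt.trans (le_max_left _ _), hVtr.trans (le_max_left _ _), hVrr'.trans (le_max_right _ _)⟩ }

end RWJet

end EternalPapapetrou.ModeRigidity

end Summit.FinalStateConjecture.FinalStateConjecture.Theorems
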